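import Summits.KontsevichZagierPeriods.KontsevichZagierPeriods.Theorems.HurwitzMicroSectorsHurwitzSectorComplementStubAssemblyAuxReps

/-!
# `HurwitzSectorComplement` (stmt-KontsevichZagierPeriods-14341), line `chebyshev-level-deformation`,
# stub S5 `stub_assembly` — part 3/4: the reduction to the normal form

Under the hypotheses of the stub — the four descents (C1)–(C4) (conclusion of S3: the Chebyshev box
representations `[T(tan(πj/L), t)]`, `[U(tan(πj/L), t)]`, `[1/(1−t)]`, `[1/(1+t)]` lie in `ℚ·𝔭_w`) and
the partial fractions / half-angle identities (P1)–(P3) (S4) — every representation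
`[(0,1)^w, Q(t) + R(t)/(1 − t^N)]` with REAL ALGEBRAIC coefficients (`deg R < N`, `R`
`(−1)^w`-symmetric, `R_{N−1} = 0` for odd `w`) is reduced to a normal form
`[(0,1)^w, C + A·∏ 2/(1+xᵢ²)]`, `C, A ∈ ℚ̄ ∩ ℝ` (`red_main`):

* the kernels are reduced (`red_T`, `red_U`, `red_invOneSub`, `red_invOneAdd`), hence the cosine and
  sine kernels `(cos u_j − t)/(1 − 2cos u_j t + t²)`, `sin u_j/(1 − 2cos u_j t + t²)`, `u_j = 2πj/L`,
  for ALL `j < L` (`j = 0`, `2j = L`, and the fold `j ↦ L − j`);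
* each symmetric pair `(t^{a−1} + (−1)^w t^{L−1−a})/(1 − t^L)` is reduced (partial fractions (P1)/(P2),
  algebraic coefficients `cos, sin(2πja/L)`): `red_pair`;
* each RATIONAL symmetric representation is reduced: the landed `stub_symReduction` at level `4N`
  followed by `red_pair`: `red_symm`;
* the real-algebraic case: symmetric splitting into algebraic multiples of rational symmetric
  representations (`eval_symm_split`): `red_main`.

References: M. Kontsevich, D. Zagier, *Periods* (2001), §1.2.
-/

noncomputable section

open Set MeasureTheory
open scoped BigOperators
open Literature.NumberTheory.Transcendental

namespace Summit.KontsevichZagierPeriods.Theorems.HurwitzMicroSectorsHurwitzSectorComplement.Assembly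

variable {w : ℕ}

/-! ## The descents (hypotheses of the stub) make the Chebyshev kernels reduced -/

section Descent

-- The four descents (conclusion of S3 `stub_ladderDescent`), verbatim.
variable (hDesc : (∀ (w j L : ℕ), 2 ≤ w → Even w → 0 < j → 2 * j < L → ∀ (r : KZ.IntegralRep w),
      r.domain = {x | ∀ i, x i ∈ Set.Ioo (0:ℝ) 1} →
      Set.EqOn r.integrand (fun x =>
        ((1 - ∏ i, x i) - (Real.tan (Real.pi * j / L)) ^ 2 * (1 + ∏ i, x i)) /
          ((1 - ∏ i, x i) ^ 2 + (Real.tan (Real.pi * j / L)) ^ 2 * (1 + ∏ i, x i) ^ 2)) r.domain →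
      ∃ q : ℚ, ∀ (s : KZ.IntegralRep w), s.domain = {x | ∀ i, x i ∈ Set.Ioo (0:ℝ) 1} →
        Set.EqOn s.integrand (fun x => (q : ℝ) * ∏ i, 2 / (1 + (x i) ^ 2)) s.domain →
        KZ.Equivalent r s) ∧
    (∀ (w j L : ℕ), 3 ≤ w → Odd w → 0 < j → 2 * j < L → ∀ (r : KZ.IntegralRep w),
      r.domain = {x | ∀ i, x i ∈ Set.Ioo (0:ℝ) 1} →
      Set.EqOn r.integrand (fun x =>
        2 * Real.tan (Real.pi * j / L) /
          ((1 - ∏ i, x i) ^ 2 + (Real.tan (Real.pi * j / L)) ^ 2 * (1 + ∏ i, x i) ^ 2)) r.domain →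
      ∃ q : ℚ, ∀ (s : KZ.IntegralRep w), s.domain = {x | ∀ i, x i ∈ Set.Ioo (0:ℝ) 1} →
        Set.EqOn s.integrand (fun x => (q : ℝ) * ∏ i, 2 / (1 + (x i) ^ 2)) s.domain →
        KZ.Equivalent r s) ∧
    (∀ (w : ℕ), 2 ≤ w → Even w → ∀ (r : KZ.IntegralRep w),
      r.domain = {x | ∀ i, x i ∈ Set.Ioo (0:ℝ) 1} →
      Set.EqOn r.integrand (fun x => 1 / (1 - ∏ i, x i)) r.domain →
      ∃ q : ℚ, ∀ (s : KZ.IntegralRep w), s.domain = {x | ∀ i, x i ∈ Set.Ioo (0:ℝ) 1} →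
        Set.EqOn s.integrand (fun x => (q : ℝ) * ∏ i, 2 / (1 + (x i) ^ 2)) s.domain →
        KZ.Equivalent r s) ∧
    (∀ (w : ℕ), 2 ≤ w → Even w → ∀ (r : KZ.IntegralRep w),
      r.domain = {x | ∀ i, x i ∈ Set.Ioo (0:ℝ) 1} →
      Set.EqOn r.integrand (fun x => 1 / (1 + ∏ i, x i)) r.domain →
      ∃ q : ℚ, ∀ (s : KZ.IntegralRep w), s.domain = {x | ∀ i, x i ∈ Set.Ioo (0:ℝ) 1} →
        Set.EqOn s.integrand (fun x => (q : ℝ) * ∏ i, 2 / (1 + (x i) ^ 2)) s.domain →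
        KZ.Equivalent r s))

include hDesc

/-- The `T`-kernel at a cyclotomic half-angle is reduced (descent (C1)). [cite: KontsevichZagier2001, §1.2] -/
theorem red_T {j L : ℕ} (hw : 2 ≤ w) (he : Even w) (hj : 0 < j) (hjL : 2 * j < L) :
    ∃ (C A : ℝ) (s n : KZ.IntegralRep w), IsAlgebraic ℚ C ∧ IsAlgebraic ℚ A ∧
      s.domain = KZ.unitCube w ∧ n.domain = KZ.unitCube w ∧
      (∀ x ∈ KZ.unitCube w, s.integrand x = ((1 - ∏ i, x i) - (Real.tan (Real.pi * j / L)) ^ 2 * (1 + ∏ i, x i)) / ((1 - ∏ i, x i) ^ 2 + (Real.tan (Real.pi * j / L)) ^ 2 * (1 + ∏ i, x i) ^ 2)) ∧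
      (∀ x ∈ KZ.unitCube w, n.integrand x = C + A * ∏ i, 2 / (1 + (x i) ^ 2)) ∧
      KZ.Equivalent s n := by
  obtain ⟨s, hsd, hsi⟩ :=
    exists_TRep w (isAlgebraic_tan_pi_mul_div j L) (tan_pi_mul_div_pos hj hjL).ne'
  exact red_of_ratMultiple s hsd (fun x _ => by rw [hsi])
    (hDesc.1 w j L hw he hj hjL s hsd fun x _ => by rw [hsi])

/-- The `U`-kernel at a cyclotomic half-angle is reduced (descent (C2)). [cite: KontsevichZagier2001, §1.2] -/
theorem red_U {j L : ℕ} (hw : 3 ≤ w) (ho : Odd w) (hj : 0 < j) (hjL : 2 * j < L) :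
    ∃ (C A : ℝ) (s n : KZ.IntegralRep w), IsAlgebraic ℚ C ∧ IsAlgebraic ℚ A ∧
      s.domain = KZ.unitCube w ∧ n.domain = KZ.unitCube w ∧
      (∀ x ∈ KZ.unitCube w, s.integrand x = 2 * Real.tan (Real.pi * j / L) / ((1 - ∏ i, x i) ^ 2 + (Real.tan (Real.pi * j / L)) ^ 2 * (1 + ∏ i, x i) ^ 2)) ∧
      (∀ x ∈ KZ.unitCube w, n.integrand x = C + A * ∏ i, 2 / (1 + (x i) ^ 2)) ∧
      KZ.Equivalent s n := by
  obtain ⟨s, hsd, hsi⟩ :=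
    exists_URep w (isAlgebraic_tan_pi_mul_div j L) (tan_pi_mul_div_pos hj hjL).ne'
  exact red_of_ratMultiple s hsd (fun x _ => by rw [hsi])
    (hDesc.2.1 w j L hw ho hj hjL s hsd fun x _ => by rw [hsi])

/-- `1/(1 − t)` is reduced for even `w ≥ 2` (descent (C3), `ζ(w) ∈ ℚ π^w`). [cite: KontsevichZagier2001, §1.2] -/
theorem red_invOneSub (hw : 2 ≤ w) (he : Even w) :
    ∃ (C A : ℝ) (s n : KZ.IntegralRep w), IsAlgebraic ℚ C ∧ IsAlgebraic ℚ A ∧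
      s.domain = KZ.unitCube w ∧ n.domain = KZ.unitCube w ∧
      (∀ x ∈ KZ.unitCube w, s.integrand x = 1 / (1 - ∏ i, x i)) ∧
      (∀ x ∈ KZ.unitCube w, n.integrand x = C + A * ∏ i, 2 / (1 + (x i) ^ 2)) ∧
      KZ.Equivalent s n := by
  obtain ⟨s, hsd, hsi⟩ := exists_invOneSubRep (w := w) hw
  exact red_of_ratMultiple s hsd (fun x _ => by rw [hsi])
    (hDesc.2.2.1 w hw he s hsd fun x _ => by rw [hsi])

/-- `1/(1 + t)` is reduced for even `w ≥ 2` (descent (C4)). [cite: KontsevichZagier2001, §1.2] -/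
theorem red_invOneAdd (hw : 2 ≤ w) (he : Even w) :
    ∃ (C A : ℝ) (s n : KZ.IntegralRep w), IsAlgebraic ℚ C ∧ IsAlgebraic ℚ A ∧
      s.domain = KZ.unitCube w ∧ n.domain = KZ.unitCube w ∧
      (∀ x ∈ KZ.unitCube w, s.integrand x = 1 / (1 + ∏ i, x i)) ∧
      (∀ x ∈ KZ.unitCube w, n.integrand x = C + A * ∏ i, 2 / (1 + (x i) ^ 2)) ∧
      KZ.Equivalent s n := by
  obtain ⟨s, hsd, hsi⟩ := exists_invOneAddRep w
  exact red_of_ratMultiple s hsd (fun x _ => by rw [hsi])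
    (hDesc.2.2.2 w hw he s hsd fun x _ => by rw [hsi])

-- The partial fractions and half-angle identities (S4 `stub_partialFractions`), verbatim.
variable (hPF : (∀ (L a : ℕ), 0 < a → a < L → ∀ (t : ℝ), 0 ≤ t → t < 1 →
      (t ^ (a - 1) + t ^ (L - 1 - a)) / (1 - t ^ L) =
        2 / (L : ℝ) * ∑ j ∈ Finset.range L, Real.cos (2 * Real.pi * j * a / L) *
          ((Real.cos (2 * Real.pi * j / L) - t) / (1 - 2 * Real.cos (2 * Real.pi * j / L) * t + t ^ 2))) ∧
    (∀ (L a : ℕ), 0 < a → a < L → ∀ (t : ℝ), 0 ≤ t → t < 1 →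
      (t ^ (a - 1) - t ^ (L - 1 - a)) / (1 - t ^ L) =
        2 / (L : ℝ) * ∑ j ∈ Finset.range L, Real.sin (2 * Real.pi * j * a / L) *
          (Real.sin (2 * Real.pi * j / L) / (1 - 2 * Real.cos (2 * Real.pi * j / L) * t + t ^ 2))) ∧
    (∀ (u t : ℝ), 0 < u → u < Real.pi →
      (Real.cos u - t) / (1 - 2 * Real.cos u * t + t ^ 2) =
        ((1 - t) - (Real.tan (u / 2)) ^ 2 * (1 + t)) / ((1 - t) ^ 2 + (Real.tan (u / 2)) ^ 2 * (1 + t) ^ 2) ∧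
      Real.sin u / (1 - 2 * Real.cos u * t + t ^ 2) =
        2 * Real.tan (u / 2) / ((1 - t) ^ 2 + (Real.tan (u / 2)) ^ 2 * (1 + t) ^ 2)))

include hPF

/-- The cosine kernel `(cos u_j − t)/(1 − 2 cos u_j t + t²)`, `u_j = 2πj/L`, `0 < j < L/2`, is the
`T`-kernel at `tan(πj/L)` (half-angle form (P3)), hence reduced for even `w`. [folklore] -/
theorem red_cosKernel_small {j L : ℕ} (hw : 2 ≤ w) (he : Even w) (hj : 0 < j) (hjL : 2 * j < L) :
    ∃ (C A : ℝ) (s n : KZ.IntegralRep w), IsAlgebraic ℚ C ∧ IsAlgebraic ℚ A ∧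
      s.domain = KZ.unitCube w ∧ n.domain = KZ.unitCube w ∧
      (∀ x ∈ KZ.unitCube w, s.integrand x = (Real.cos (2 * Real.pi * j / L) - ∏ i, x i) / (1 - 2 * Real.cos (2 * Real.pi * j / L) * (∏ i, x i) + (∏ i, x i) ^ 2)) ∧
      (∀ x ∈ KZ.unitCube w, n.integrand x = C + A * ∏ i, 2 / (1 + (x i) ^ 2)) ∧
      KZ.Equivalent s n := by
  obtain ⟨hu0, huπ, hu2⟩ := angle_mem hj hjL
  refine red_congr (red_T hDesc hw he hj hjL) fun x _ => ?_
  have h := (hPF.2.2 (2 * Real.pi * j / L) (∏ i, x i) hu0 huπ).1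
  rw [hu2] at h
  exact h.symm

/-- The sine kernel `sin u_j/(1 − 2 cos u_j t + t²)`, `0 < j < L/2`, is the `U`-kernel at
`tan(πj/L)`, hence reduced for odd `w ≥ 3`. [folklore] -/
theorem red_sinKernel_small {j L : ℕ} (hw : 3 ≤ w) (ho : Odd w) (hj : 0 < j) (hjL : 2 * j < L) :
    ∃ (C A : ℝ) (s n : KZ.IntegralRep w), IsAlgebraic ℚ C ∧ IsAlgebraic ℚ A ∧
      s.domain = KZ.unitCube w ∧ n.domain = KZ.unitCube w ∧
      (∀ x ∈ KZ.unitCube w, s.integrand x = Real.sin (2 * Real.pi * j / L) / (1 - 2 * Real.cos (2 * Real.pi * j / L) * (∏ i, x i) + (∏ i, x i) ^ 2)) ∧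
      (∀ x ∈ KZ.unitCube w, n.integrand x = C + A * ∏ i, 2 / (1 + (x i) ^ 2)) ∧
      KZ.Equivalent s n := by
  obtain ⟨hu0, huπ, hu2⟩ := angle_mem hj hjL
  refine red_congr (red_U hDesc hw ho hj hjL) fun x _ => ?_
  have h := (hPF.2.2 (2 * Real.pi * j / L) (∏ i, x i) hu0 huπ).2
  rw [hu2] at h
  exact h.symm

/-- The cosine kernel is reduced for EVERY `j < L` (even `w ≥ 2`): `j = 0` is `1/(1−t)` (C3),
`2j = L` is `−1/(1+t)` (C4), `L/2 < j < L` folds to `L − j`. [folklore] -/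
theorem red_cosKernel {j L : ℕ} (hw : 2 ≤ w) (he : Even w) (hjL : j < L) :
    ∃ (C A : ℝ) (s n : KZ.IntegralRep w), IsAlgebraic ℚ C ∧ IsAlgebraic ℚ A ∧
      s.domain = KZ.unitCube w ∧ n.domain = KZ.unitCube w ∧
      (∀ x ∈ KZ.unitCube w, s.integrand x = (Real.cos (2 * Real.pi * j / L) - ∏ i, x i) / (1 - 2 * Real.cos (2 * Real.pi * j / L) * (∏ i, x i) + (∏ i, x i) ^ 2)) ∧
      (∀ x ∈ KZ.unitCube w, n.integrand x = C + A * ∏ i, 2 / (1 + (x i) ^ 2)) ∧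
      KZ.Equivalent s n := by
  have hL : (L : ℝ) ≠ 0 := by exact_mod_cast (show L ≠ 0 by omega)
  rcases Nat.eq_zero_or_pos j with rfl | hj
  · refine red_congr (red_invOneSub hDesc hw he) fun x hx => ?_
    have ht := BoxIntegral.prod_mem_Ioo (n := w) (by omega) hx
    rw [Nat.cast_zero, mul_zero, zero_div, Real.cos_zero]
    generalize ∏ i, x i = t at ht ⊢
    have h1 : 1 - t ≠ 0 := (sub_pos.mpr ht.2).ne'
    have h2 : (1 - 2 * 1 * t + t ^ 2) = (1 - t) * (1 - t) := by ring
    rw [h2, div_mul_cancel_left₀ h1, one_div]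
  rcases lt_trichotomy (2 * j) L with h2 | h2 | h2
  · exact red_cosKernel_small hDesc hPF hw he hj h2
  · refine red_congr (red_smul (red_invOneAdd hDesc hw he) isAlgebraic_one.neg) fun x hx => ?_
    have hπ : 2 * Real.pi * j / L = Real.pi := by
      rw [show (L : ℝ) = 2 * j by exact_mod_cast h2.symm]
      field_simp
    rw [hπ, Real.cos_pi]
    have ht := prod_nonneg_of_mem hx
    generalize ∏ i, x i = t at ht ⊢
    have h1 : (1 + t) ≠ 0 := by positivity
    have h2 : (1 - 2 * -1 * t + t ^ 2) = (1 + t) * (1 + t) := by ring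
    have h3 : (-1 - t) = -(1 + t) := by ring
    rw [h2, h3, neg_div, div_mul_cancel_left₀ h1, one_div]
    ring
  · have hj' : 0 < L - j ∧ 2 * (L - j) < L := ⟨by omega, by omega⟩
    refine red_congr (red_cosKernel_small hDesc hPF hw he hj'.1 hj'.2) fun x _ => ?_
    have hc : Real.cos (2 * Real.pi * (L - j : ℕ) / L) = Real.cos (2 * Real.pi * j / L) := by
      rw [Nat.cast_sub hjL.le, show 2 * Real.pi * ((L : ℝ) - j) / L =
        2 * Real.pi - 2 * Real.pi * j / L by field_simp]
      exact Real.cos_two_pi_sub _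
    rw [hc]

/-- The sine kernel is reduced for EVERY `j < L` (odd `w ≥ 3`): it vanishes at `j = 0` and
`2j = L`, and `L/2 < j < L` folds to `L − j` with a sign. [folklore] -/
theorem red_sinKernel {j L : ℕ} (hw : 3 ≤ w) (ho : Odd w) (hjL : j < L) :
    ∃ (C A : ℝ) (s n : KZ.IntegralRep w), IsAlgebraic ℚ C ∧ IsAlgebraic ℚ A ∧
      s.domain = KZ.unitCube w ∧ n.domain = KZ.unitCube w ∧
      (∀ x ∈ KZ.unitCube w, s.integrand x = Real.sin (2 * Real.pi * j / L) / (1 - 2 * Real.cos (2 * Real.pi * j / L) * (∏ i, x i) + (∏ i, x i) ^ 2)) ∧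
      (∀ x ∈ KZ.unitCube w, n.integrand x = C + A * ∏ i, 2 / (1 + (x i) ^ 2)) ∧
      KZ.Equivalent s n := by
  have hL : (L : ℝ) ≠ 0 := by exact_mod_cast (show L ≠ 0 by omega)
  rcases Nat.eq_zero_or_pos j with rfl | hj
  · refine red_congr (red_const w isAlgebraic_zero) fun x _ => ?_
    simp only [Nat.cast_zero, mul_zero, zero_div, Real.sin_zero]
  rcases lt_trichotomy (2 * j) L with h2 | h2 | h2
  · exact red_sinKernel_small hDesc hPF hw ho hj h2
  · refine red_congr (red_const w isAlgebraic_zero) fun x _ => ?_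
    have hπ : 2 * Real.pi * j / L = Real.pi := by
      rw [show (L : ℝ) = 2 * j by exact_mod_cast h2.symm]
      field_simp
    rw [hπ, Real.sin_pi, zero_div]
  · have hj' : 0 < L - j ∧ 2 * (L - j) < L := ⟨by omega, by omega⟩
    refine red_congr (red_smul (red_sinKernel_small hDesc hPF hw ho hj'.1 hj'.2)
      isAlgebraic_one.neg) fun x _ => ?_
    have hθ : 2 * Real.pi * (L - j : ℕ) / L = 2 * Real.pi - 2 * Real.pi * j / L := by
      rw [Nat.cast_sub hjL.le]
      field_simp
    rw [hθ, Real.cos_two_pi_sub, Real.sin_two_pi_sub]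
    ring

/-- **Galois descent of a symmetric pair.** For `0 < a < L` and `w ≥ 2` the pair integrand
`(t^{a−1} + (−1)^w t^{L−1−a})/(1 − t^L)` is reduced: by the real-cyclotomic partial fractions
(P1) (even `w`) / (P2) (odd `w`) it is an algebraic combination of the cosine / sine kernels,
each of which is reduced (`red_cosKernel`, `red_sinKernel`). [folklore] -/
theorem red_pair {L a : ℕ} (hw : 2 ≤ w) (ha : 0 < a) (haL : a < L) :
    ∃ (C A : ℝ) (s n : KZ.IntegralRep w), IsAlgebraic ℚ C ∧ IsAlgebraic ℚ A ∧
      s.domain = KZ.unitCube w ∧ n.domain = KZ.unitCube w ∧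
      (∀ x ∈ KZ.unitCube w, s.integrand x = ((∏ i, x i) ^ (a - 1) + (-1 : ℝ) ^ w * (∏ i, x i) ^ (L - 1 - a)) / (1 - (∏ i, x i) ^ L)) ∧
      (∀ x ∈ KZ.unitCube w, n.integrand x = C + A * ∏ i, 2 / (1 + (x i) ^ 2)) ∧
      KZ.Equivalent s n := by
  have h2L : IsAlgebraic ℚ (2 / (L : ℝ)) := by
    have h := isAlgebraic_rat ℚ (A := ℝ) ((2 : ℚ) / L)
    push_cast at h
    exact h
  rcases Nat.even_or_odd w with he | ho
  · have hred : ∃ (C A : ℝ) (s n : KZ.IntegralRep w), IsAlgebraic ℚ C ∧ IsAlgebraic ℚ A ∧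
          s.domain = KZ.unitCube w ∧ n.domain = KZ.unitCube w ∧
          (∀ x ∈ KZ.unitCube w, s.integrand x = 2 / (L : ℝ) * ∑ j ∈ Finset.range L, Real.cos (2 * Real.pi * j * a / L) * ((Real.cos (2 * Real.pi * j / L) - ∏ i, x i) / (1 - 2 * Real.cos (2 * Real.pi * j / L) * (∏ i, x i) + (∏ i, x i) ^ 2))) ∧
          (∀ x ∈ KZ.unitCube w, n.integrand x = C + A * ∏ i, 2 / (1 + (x i) ^ 2)) ∧
          KZ.Equivalent s n :=
      red_smul (red_sum (Finset.range L) fun j hj =>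
        red_smul (red_cosKernel hDesc hPF hw he (Finset.mem_range.mp hj))
          (PairValueAlgebraic.isAlgebraic_cos_two_pi_mul j a L)) h2L
    refine red_congr hred fun x hx => ?_
    have ht := BoxIntegral.prod_mem_Ioo (n := w) (by omega) hx
    rw [← hPF.1 L a ha haL (∏ i, x i) ht.1.le ht.2, he.neg_one_pow, one_mul]
  · have hw3 : 3 ≤ w := by
      obtain ⟨m, rfl⟩ := ho
      omega
    have hred : ∃ (C A : ℝ) (s n : KZ.IntegralRep w), IsAlgebraic ℚ C ∧ IsAlgebraic ℚ A ∧
          s.domain = KZ.unitCube w ∧ n.domain = KZ.unitCube w ∧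
          (∀ x ∈ KZ.unitCube w, s.integrand x = 2 / (L : ℝ) * ∑ j ∈ Finset.range L, Real.sin (2 * Real.pi * j * a / L) * (Real.sin (2 * Real.pi * j / L) / (1 - 2 * Real.cos (2 * Real.pi * j / L) * (∏ i, x i) + (∏ i, x i) ^ 2))) ∧
          (∀ x ∈ KZ.unitCube w, n.integrand x = C + A * ∏ i, 2 / (1 + (x i) ^ 2)) ∧
          KZ.Equivalent s n :=
      red_smul (red_sum (Finset.range L) fun j hj =>
        red_smul (red_sinKernel hDesc hPF hw3 ho (Finset.mem_range.mp hj))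
          (PairValueAlgebraic.isAlgebraic_sin_two_pi_mul j a L)) h2L
    refine red_congr hred fun x hx => ?_
    have ht := BoxIntegral.prod_mem_Ioo (n := w) (by omega) hx
    rw [← hPF.2.1 L a ha haL (∏ i, x i) ht.1.le ht.2, ho.neg_one_pow, neg_one_mul,
      sub_eq_add_neg]

/-- **A rational symmetric representation is reduced**: the landed rational reduction
`stub_symReduction` (level `4N`) moves `[(0,1)^w, Q(t) + R(t)/(1 − t^N)]` (`Q, R ∈ ℚ[t]`,
`R` `(−1)^w`-symmetric) to `[(0,1)^w, c + Σ_{a ∈ T} μ_a (t^{a−1} + (−1)^w t^{4N−1−a})/(1 − t^{4N})]`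
with `c, μ_a ∈ ℚ`, and every pair is reduced (`red_pair`). [cite: KontsevichZagier2001, §1.2] -/
theorem red_symm {N : ℕ} (hw : 2 ≤ w) (hN : 1 ≤ N) (Q R : Polynomial ℚ)
    (hR : R.natDegree < N)
    (hsym : ∀ i j : ℕ, i + j + 2 = N → R.coeff i = (-1 : ℚ) ^ w * R.coeff j)
    (hodd : Odd w → R.coeff (N - 1) = 0) :
    ∃ (C A : ℝ) (s n : KZ.IntegralRep w), IsAlgebraic ℚ C ∧ IsAlgebraic ℚ A ∧
      s.domain = KZ.unitCube w ∧ n.domain = KZ.unitCube w ∧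
      (∀ x ∈ KZ.unitCube w, s.integrand x = Polynomial.aeval (∏ i, x i) Q + Polynomial.aeval (∏ i, x i) R / (1 - (∏ i, x i) ^ N)) ∧
      (∀ x ∈ KZ.unitCube w, n.integrand x = C + A * ∏ i, 2 / (1 + (x i) ^ 2)) ∧
      KZ.Equivalent s n := by
  obtain ⟨σ, hσd, hσi⟩ := SymReduction.exists_sectorFamily (w := w) hw hN
  have hsi : ∀ x ∈ KZ.unitCube w,
      (σ (Q * (1 - Polynomial.X ^ N) + R)).integrand x = Polynomial.aeval (∏ i, x i) Q +
        Polynomial.aeval (∏ i, x i) R / (1 - (∏ i, x i) ^ N) := by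
    intro x hx
    have ht := BoxIntegral.prod_mem_Ioo (n := w) (by omega) hx
    rw [hσi]
    simp only [map_add, map_mul, map_sub, map_one, map_pow, Polynomial.aeval_X]
    have h1 : (1 : ℝ) - (∏ i, x i) ^ N ≠ 0 := SymReduction.one_sub_pow_ne_zero ht (by omega)
    field_simp
  obtain ⟨c, μ, r', hr'd, hr'i, hsr'⟩ := stub_symReduction w N (4 * N) hw hN (by omega)
    ⟨4, by ring⟩ (σ (Q * (1 - Polynomial.X ^ N) + R)) Q R hR hsym hodd (hσd _)
    fun x hx => hsi x (by rw [hσd] at hx; exact hx)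
  have hT : ∀ b ∈ (Finset.range (4 * N)).filter (fun b => 2 * b < 4 * N ∧ Nat.Coprime b (4 * N)),
      0 < b ∧ b < 4 * N := by
    intro b hb
    simp only [Finset.mem_filter, Finset.mem_range] at hb
    refine ⟨Nat.pos_of_ne_zero fun h0 => ?_, hb.1⟩
    subst h0
    have h1 : 4 * N = 1 := (Nat.coprime_zero_left _).mp hb.2.2
    omega
  have hred : ∃ (C A : ℝ) (s n : KZ.IntegralRep w), IsAlgebraic ℚ C ∧ IsAlgebraic ℚ A ∧
        s.domain = KZ.unitCube w ∧ n.domain = KZ.unitCube w ∧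
        (∀ x ∈ KZ.unitCube w, s.integrand x = (c : ℝ) + ∑ a ∈ (Finset.range (4 * N)).filter (fun a => 2 * a < 4 * N ∧ Nat.Coprime a (4 * N)), (μ a : ℝ) * (((∏ i, x i) ^ (a - 1) + (-1 : ℝ) ^ w * (∏ i, x i) ^ (4 * N - 1 - a)) / (1 - (∏ i, x i) ^ (4 * N)))) ∧
        (∀ x ∈ KZ.unitCube w, n.integrand x = C + A * ∏ i, 2 / (1 + (x i) ^ 2)) ∧
        KZ.Equivalent s n :=
    red_add (red_const w (isAlgebraic_rat ℚ c)) (red_sum _ fun b hb =>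
      red_smul (red_pair hDesc hPF hw (hT b hb).1 (hT b hb).2) (isAlgebraic_rat ℚ (μ b)))
  obtain ⟨C, A, s₂, n, hC, hA, hs₂d, hnd, hs₂i, hni, hs₂n⟩ := hred
  refine ⟨C, A, σ _, n, hC, hA, hσd _, hnd, hsi, hni, ?_⟩
  refine (hsr'.trans (KZ.of_sub_of_mem_relations_of_eqOn (hs₂d.trans hr'd.symm)
    fun x hx => ?_)).trans hs₂n
  rw [hr'i hx, hs₂i x (by rw [hr'd] at hx; exact hx)]

/-- **(Red) for the real-algebraic symmetric tower.** `Q(t) + R(t)/(1 − t^N)` with `Q, R ∈ (ℚ̄ ∩ ℝ)[t]`,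
`deg R < N`, `R` `(−1)^w`-symmetric (`R_{N−1} = 0` for odd `w`) is reduced: it is the algebraic
combination `Σ_k Q_k·t^k + Σ_{i<N−1} (R_i/2)·(t^i + (−1)^w t^{N−2−i})/(1−t^N) + R_{N−1}·t^{N−1}/(1−t^N)`
of RATIONAL symmetric representations, each reduced by `red_symm`. [cite: KontsevichZagier2001, §1.2] -/
theorem red_main {N : ℕ} (hw : 2 ≤ w) (hN : 1 ≤ N) (Q R : Polynomial ℝ)
    (hQ : ∀ i, IsAlgebraic ℚ (Q.coeff i)) (hRa : ∀ i, IsAlgebraic ℚ (R.coeff i))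
    (hR : R.natDegree < N)
    (hsym : ∀ i j : ℕ, i + j + 2 = N → R.coeff i = (-1 : ℝ) ^ w * R.coeff j)
    (hodd : Odd w → R.coeff (N - 1) = 0) :
    ∃ (C A : ℝ) (s n : KZ.IntegralRep w), IsAlgebraic ℚ C ∧ IsAlgebraic ℚ A ∧
      s.domain = KZ.unitCube w ∧ n.domain = KZ.unitCube w ∧
      (∀ x ∈ KZ.unitCube w, s.integrand x = Polynomial.eval (∏ i, x i) Q + Polynomial.eval (∏ i, x i) R / (1 - (∏ i, x i) ^ N)) ∧
      (∀ x ∈ KZ.unitCube w, n.integrand x = C + A * ∏ i, 2 / (1 + (x i) ^ 2)) ∧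
      KZ.Equivalent s n := by
  have h2 : IsAlgebraic ℚ (2 : ℝ) := by simpa using isAlgebraic_nat (R := ℚ) (A := ℝ) 2
  -- the polynomial part
  have hQred : ∃ (C A : ℝ) (s n : KZ.IntegralRep w), IsAlgebraic ℚ C ∧ IsAlgebraic ℚ A ∧
        s.domain = KZ.unitCube w ∧ n.domain = KZ.unitCube w ∧
        (∀ x ∈ KZ.unitCube w, s.integrand x = ∑ k ∈ Finset.range (Q.natDegree + 1), Q.coeff k * (∏ i, x i) ^ k) ∧
        (∀ x ∈ KZ.unitCube w, n.integrand x = C + A * ∏ i, 2 / (1 + (x i) ^ 2)) ∧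
        KZ.Equivalent s n := by
    refine red_sum _ fun k _ => red_smul (red_congr (red_symm hDesc hPF hw hN
      (Polynomial.X ^ k) 0 (by rw [Polynomial.natDegree_zero]; omega) (fun i j _ => by simp)
      (fun _ => by simp)) fun x _ => ?_) (hQ k)
    simp
  -- the symmetric pairs
  have hPred : ∃ (C A : ℝ) (s n : KZ.IntegralRep w), IsAlgebraic ℚ C ∧ IsAlgebraic ℚ A ∧
        s.domain = KZ.unitCube w ∧ n.domain = KZ.unitCube w ∧
        (∀ x ∈ KZ.unitCube w, s.integrand x = ∑ k ∈ Finset.range (N - 1), R.coeff k / 2 * (((∏ i, x i) ^ k + (-1 : ℝ) ^ w * (∏ i, x i) ^ (N - 2 - k)) / (1 - (∏ i, x i) ^ N))) ∧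
        (∀ x ∈ KZ.unitCube w, n.integrand x = C + A * ∏ i, 2 / (1 + (x i) ^ 2)) ∧
        KZ.Equivalent s n := by
    refine red_sum _ fun k hk => red_smul (red_congr (red_symm hDesc hPF hw hN 0
      (Polynomial.X ^ k + Polynomial.C ((-1 : ℚ) ^ w) * Polynomial.X ^ (N - 2 - k))
      (symmPair_shape (Finset.mem_range.mp hk)).1 (symmPair_shape (Finset.mem_range.mp hk)).2.1
      (fun _ => (symmPair_shape (Finset.mem_range.mp hk)).2.2)) fun x _ => ?_)
      ((hRa k).mul h2.inv)
    simp only [map_zero, zero_add, map_add, map_pow, map_mul, Polynomial.aeval_X,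
      Polynomial.aeval_C, eq_ratCast]
    push_cast
    ring
  -- the top monomial
  have hTred : ∃ (C A : ℝ) (s n : KZ.IntegralRep w), IsAlgebraic ℚ C ∧ IsAlgebraic ℚ A ∧
        s.domain = KZ.unitCube w ∧ n.domain = KZ.unitCube w ∧
        (∀ x ∈ KZ.unitCube w, s.integrand x = R.coeff (N - 1) * ((∏ i, x i) ^ (N - 1) / (1 - (∏ i, x i) ^ N))) ∧
        (∀ x ∈ KZ.unitCube w, n.integrand x = C + A * ∏ i, 2 / (1 + (x i) ^ 2)) ∧
        KZ.Equivalent s n := by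
    by_cases ho : Odd w
    · refine red_congr (red_const w isAlgebraic_zero) fun x _ => ?_
      rw [hodd ho, zero_mul]
    · refine red_smul (red_congr (red_symm hDesc hPF hw hN 0 (Polynomial.X ^ (N - 1))
        (topMonomial_shape (w := w) hN).1 (topMonomial_shape hN).2 (fun h => absurd h ho))
        fun x _ => ?_) (hRa (N - 1))
      simp only [map_zero, zero_add, map_pow, Polynomial.aeval_X]
  refine red_congr (red_add hQred (red_add hPred hTred)) fun x _ => ?_
  rw [Polynomial.eval_eq_sum_range, eval_symm_split R hN hR hsym, add_div, Finset.sum_div]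
  congr 1
  congr 1
  · exact Finset.sum_congr rfl fun k _ => by ring
  · ring

end Descent

end Summit.KontsevichZagierPeriods.Theorems.HurwitzMicroSectorsHurwitzSectorComplement.Assembly

namespace Summit.KontsevichZagierPeriods.Theorems.HurwitzMicroSectorsHurwitzSectorComplement

/-- **Registered sub-goal `assemblyDescent_redMain` of `stub_assembly`**: under the descents (S3) and the
partial fractions (S4), every real-algebraic symmetric representation is reduced to a normal form
`[(0,1)^w, C + A·∏ 2/(1+xᵢ²)]` with `C, A` real algebraic (`Assembly.red_main`).
[cite: KontsevichZagier2001, §1.2] -/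
theorem assemblyDescent_redMain : ((∀ (w j L : ℕ), 2 ≤ w → Even w → 0 < j → 2 * j < L → ∀ (r : KZ.IntegralRep w), r.domain = {x | ∀ i, x i ∈ Set.Ioo (0:ℝ) 1} → Set.EqOn r.integrand (fun x => ((1 - ∏ i, x i) - (Real.tan (Real.pi * j / L)) ^ 2 * (1 + ∏ i, x i)) / ((1 - ∏ i, x i) ^ 2 + (Real.tan (Real.pi * j / L)) ^ 2 * (1 + ∏ i, x i) ^ 2)) r.domain → ∃ q : ℚ, ∀ (s : KZ.IntegralRep w), s.domain = {x | ∀ i, x i ∈ Set.Ioo (0:ℝ) 1} → Set.EqOn s.integrand (fun x => (q : ℝ) * ∏ i, 2 / (1 + (x i) ^ 2)) s.domain → KZ.Equivalent r s) ∧ (∀ (w j L : ℕ), 3 ≤ w → Odd w → 0 < j → 2 * j < L → ∀ (r : KZ.IntegralRep w), r.domain = {x | ∀ i, x i ∈ Set.Ioo (0:ℝ) 1} → Set.EqOn r.integrand (fun x => 2 * Real.tan (Real.pi * j / L) / ((1 - ∏ i, x i) ^ 2 + (Real.tan (Real.pi * j / L)) ^ 2 * (1 + ∏ i, x i) ^ 2))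 r.domain → ∃ q : ℚ, ∀ (s : KZ.IntegralRep w), s.domain = {x | ∀ i, x i ∈ Set.Ioo (0:ℝ) 1} → Set.EqOn s.integrand (fun x => (q : ℝ) * ∏ i, 2 / (1 + (x i) ^ 2)) s.domain → KZ.Equivalent r s) ∧ (∀ (w : ℕ), 2 ≤ w → Even w → ∀ (r : KZ.IntegralRep w), r.domain = {x | ∀ i, x i ∈ Set.Ioo (0:ℝ) 1} → Set.EqOn r.integrand (fun x => 1 / (1 - ∏ i, x i)) r.domain → ∃ q : ℚ, ∀ (s : KZ.IntegralRep w), s.domain = {x | ∀ i, x i ∈ Set.Ioo (0:ℝ) 1} → Set.EqOn s.integrand (fun x => (q : ℝ) * ∏ i, 2 / (1 + (x i) ^ 2)) s.domain → KZ.Equivalent r s) ∧ (∀ (w : ℕ), 2 ≤ w → Even w → ∀ (r : KZ.IntegralRep w), r.domain = {x | ∀ i, x i ∈ Set.Ioo (0:ℝ) 1} → Set.EqOn r.integrand (fun x => 1 / (1 + ∏ i, x i)) r.domain → ∃ q : ℚ, ∀ (s : KZ.IntegralRep w), s.domain = {x | ∀ i, x i ∈ Set.Ioo (0:ℝ) 1}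 → Set.EqOn s.integrand (fun x => (q : ℝ) * ∏ i, 2 / (1 + (x i) ^ 2)) s.domain → KZ.Equivalent r s)) → ((∀ (L a : ℕ), 0 < a → a < L → ∀ (t : ℝ), 0 ≤ t → t < 1 → (t ^ (a - 1) + t ^ (L - 1 - a)) / (1 - t ^ L) = 2 / (L : ℝ) * ∑ j ∈ Finset.range L, Real.cos (2 * Real.pi * j * a / L) * ((Real.cos (2 * Real.pi * j / L) - t) / (1 - 2 * Real.cos (2 * Real.pi * j / L) * t + t ^ 2))) ∧ (∀ (L a : ℕ), 0 < a → a < L → ∀ (t : ℝ), 0 ≤ t → t < 1 → (t ^ (a - 1) - t ^ (L - 1 - a)) / (1 - t ^ L) = 2 / (L : ℝ) * ∑ j ∈ Finset.range L, Real.sin (2 * Real.pi * j * a / L) * (Real.sin (2 * Real.pi * j / L) / (1 - 2 * Real.cos (2 * Real.pi * j / L) * t + t ^ 2))) ∧ (∀ (u t : ℝ), 0 < u → u < Real.pi → (Real.cos u - t) / (1 - 2 * Real.cos u * t + t ^ 2) = ((1 - t) - (Real.tan (u / 2)) ^ 2 * (1 + t)) / ((1 - t) ^ 2 + (Real.tan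 (u / 2)) ^ 2 * (1 + t) ^ 2) ∧ Real.sin u / (1 - 2 * Real.cos u * t + t ^ 2) = 2 * Real.tan (u / 2) / ((1 - t) ^ 2 + (Real.tan (u / 2)) ^ 2 * (1 + t) ^ 2))) → ∀ (w N : ℕ), 2 ≤ w → 1 ≤ N → ∀ (Q R : Polynomial ℝ), (∀ i, IsAlgebraic ℚ (Q.coeff i)) → (∀ i, IsAlgebraic ℚ (R.coeff i)) → R.natDegree < N → (∀ i j : ℕ, i + j + 2 = N → R.coeff i = (-1 : ℝ) ^ w * R.coeff j) → (Odd w → R.coeff (N - 1) = 0) → ∃ (C A : ℝ) (s n : KZ.IntegralRep w), IsAlgebraic ℚ C ∧ IsAlgebraic ℚ A ∧ s.domain = {x | ∀ i, x i ∈ Set.Ioo (0:ℝ) 1} ∧ n.domain = {x | ∀ i, x i ∈ Set.Ioo (0:ℝ) 1} ∧ (∀ x ∈ {x : Fin w → ℝ | ∀ i, x i ∈ Set.Ioo (0:ℝ) 1}, s.integrand x = Polynomial.eval (∏ i, x i) Q + Polynomial.eval (∏ i, x i) R / (1 - (∏ i, x i) ^ N)) ∧ (∀ x ∈ {x : Fin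 w → ℝ | ∀ i, x i ∈ Set.Ioo (0:ℝ) 1}, n.integrand x = C + A * ∏ i, 2 / (1 + (x i) ^ 2)) ∧ KZ.Equivalent s n :=
  fun hDesc hPF _ _ hw hN Q R hQ hRa hR hsym hodd =>
    Assembly.red_main hDesc hPF hw hN Q R hQ hRa hR hsym hodd

end Summit.KontsevichZagierPeriods.Theorems.HurwitzMicroSectorsHurwitzSectorComplement


end
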